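import Summits.FinalStateConjecture.FinalStateConjecture.Theorems.ClusterCompletenessAdiabaticMultiKerrILEDWallBulk

/-!
# Route ClusterCompleteness — crux `AdiabaticMultiKerrILED`, line `Sketch`: the corrected wall bulk

Helper file for the crux `stmt-FinalStateConjecture-14310` (line `Sketch`, research stub
`stub_lateEnergyBound_pos`), continuing `…WallBulk.lean`: the wave operator of a **planar weight**
`ϖ = φ(ŵ·y⃗)` on Minkowski space is `|ŵ|² φ''`, and with the Lagrangian corrector
`ϖ = 2κ ζ'` (DRSR's modified current `J^{X,ϖ} = J^X + ¼ L^ϖ`, bulk `K^X + ¼ ϖ Q − ⅛ (□ϖ) w²`,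
`KerrSchild.sum_fderiv_modifiedCurrent`) the `Q`-term of the mid-frame wall bulk cancels exactly:
for a planar transition `ζ = Z(ŵ·y⃗)` at rest in the pair's mid-frame,
`K^{X,ϖ} = κ [ Z'(σ) (∂_ŵ w)² − ¼ Z'''(σ) w² ]` (`σ = ŵ·x⃗`) — a pointwise SIGNED first-order
term plus a zeroth-order term carrying the whole obstruction (crux notes §2).
Dafermos–Rodnianski–Shlapentokh-Rothman arXiv:1402.7034, §2.3.1 (modified currents); the
computations are elementary. [folklore]
-/

noncomputable section

-- the doubled `FinalStateConjecture.FinalStateConjecture` path component trips dupNamespace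
set_option linter.dupNamespace false

open scoped BigOperators Topology
open Filter Literature.Geometry.Lorentzian

namespace Summit.FinalStateConjecture.FinalStateConjecture.Cruxes.AdiabaticMultiKerrILED.Sketch

/-- The linear form `y ↦ ŵ₁y¹ + ŵ₂y² + ŵ₃y³` has derivative `ŵ₁dx¹ + ŵ₂dx² + ŵ₃dx³`. [folklore] -/
theorem hasFDerivAt_planarCoord (ŵ : Fin 4 → ℝ) (y : E4) :
    HasFDerivAt (fun z : E4 ↦ ŵ 1 * z 1 + ŵ 2 * z 2 + ŵ 3 * z 3)
      (ŵ 1 • E4.dx 1 + ŵ 2 • E4.dx 2 + ŵ 3 • E4.dx 3) y := by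
  have h := (((KerrSchild.hasFDerivAt_coord 1 y).const_mul (ŵ 1)).add
    ((KerrSchild.hasFDerivAt_coord 2 y).const_mul (ŵ 2))).add
    ((KerrSchild.hasFDerivAt_coord 3 y).const_mul (ŵ 3))
  exact h

/-- **`□_η φ(ŵ·y⃗) = |ŵ|² φ''(ŵ·y⃗)`** for the constant Minkowski coefficients and a weight depending
only on the planar coordinate `σ = ŵ₁y¹ + ŵ₂y² + ŵ₃y³`, of class `C²` at `σ(x)`
(`∂_i φ(σ) = ŵ_i φ'`, `∂_i∂_i φ(σ) = ŵ_i² φ''`, `∂_t φ(σ) = 0`). [folklore] -/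
theorem waveOperator_eta_planar {φ : ℝ → ℝ} (ŵ : Fin 4 → ℝ) {x : E4}
    (hφ : ContDiffAt ℝ 2 φ (ŵ 1 * x 1 + ŵ 2 * x 2 + ŵ 3 * x 3)) :
    KerrSchild.waveOperator (fun _ ↦ Kerr.etaComp)
        (fun y ↦ φ (ŵ 1 * y 1 + ŵ 2 * y 2 + ŵ 3 * y 3)) x =
      (ŵ 1 ^ 2 + ŵ 2 ^ 2 + ŵ 3 ^ 2) * deriv (deriv φ) (ŵ 1 * x 1 + ŵ 2 * x 2 + ŵ 3 * x 3) := by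
  -- abbreviations
  obtain ⟨S, hS⟩ : ∃ S : E4 → ℝ, ∀ y, S y = ŵ 1 * y 1 + ŵ 2 * y 2 + ŵ 3 * y 3 := ⟨_, fun _ ↦ rfl⟩
  have hSfun : (fun y : E4 ↦ ŵ 1 * y 1 + ŵ 2 * y 2 + ŵ 3 * y 3) = S := funext fun y ↦ (hS y).symm
  have hSd : ∀ y, HasFDerivAt S (ŵ 1 • E4.dx 1 + ŵ 2 • E4.dx 2 + ŵ 3 • E4.dx 3) y :=
    fun y ↦ by rw [← hSfun]; exact hasFDerivAt_planarCoord ŵ y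
  have hSc : Continuous S := continuous_iff_continuousAt.mpr fun y ↦ (hSd y).continuousAt
  have hφS : (fun z : E4 ↦ φ (ŵ 1 * z 1 + ŵ 2 * z 2 + ŵ 3 * z 3)) = fun z ↦ φ (S z) :=
    funext fun z ↦ by rw [hS]
  rw [← hS x] at hφ
  -- `φ` is differentiable near `S x`, and `deriv φ` is differentiable at `S x`
  have hφ1 : ∀ᶠ t in 𝓝 (S x), DifferentiableAt ℝ φ t := by
    have h := hφ.eventually (by simp)
    filter_upwards [h] with t ht using ht.differentiableAt (by simp)
  have hφ2 : DifferentiableAt ℝ (deriv φ) (S x) := by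
    have h1 : DifferentiableAt ℝ (fderiv ℝ φ) (S x) :=
      (hφ.fderiv_right (m := 1) le_rfl).differentiableAt (by simp)
    have h2 : deriv φ = fun t ↦ fderiv ℝ φ t 1 := funext fun t ↦ rfl
    rw [h2]
    exact h1.clm_apply (differentiableAt_const _)
  -- the inner vector field `A^μ = ∑_ν η^{μν} ∂_ν (φ ∘ S)` near `x`
  have hinner : ∀ μ : Fin 4, (fun y : E4 ↦ ∑ ν, Kerr.etaComp μ ν *
      fderiv ℝ (fun z ↦ φ (ŵ 1 * z 1 + ŵ 2 * z 2 + ŵ 3 * z 3)) y (E4.basisVector ν)) =ᶠ[𝓝 x]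
      fun y ↦ if μ = 0 then 0 else deriv φ (S y) * ŵ μ := by
    intro μ
    have hnear : ∀ᶠ y in 𝓝 x, DifferentiableAt ℝ φ (S y) := hSc.continuousAt.eventually hφ1
    filter_upwards [hnear] with y hy
    have hcomp : HasFDerivAt (fun z : E4 ↦ φ (ŵ 1 * z 1 + ŵ 2 * z 2 + ŵ 3 * z 3))
        (deriv φ (S y) • (ŵ 1 • E4.dx 1 + ŵ 2 • E4.dx 2 + ŵ 3 • E4.dx 3)) y := by
      rw [hφS]
      exact hy.hasDerivAt.comp_hasFDerivAt y (hSd y)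
    simp only [hcomp.fderiv, FunLike.coe_add, Pi.add_apply, FunLike.coe_smul, Pi.smul_apply,
      smul_eq_mul, Kerr.dx_basisVector, KerrSchild.etaComp_eq, Fin.sum_univ_four, Fin.isValue]
    fin_cases μ <;> simp
  -- differentiate `A^μ` at `x`
  have hderiv : ∀ μ : Fin 4, fderiv ℝ (fun y : E4 ↦ ∑ ν, Kerr.etaComp μ ν *
      fderiv ℝ (fun z ↦ φ (ŵ 1 * z 1 + ŵ 2 * z 2 + ŵ 3 * z 3)) y (E4.basisVector ν)) x
        (E4.basisVector μ) =
      if μ = 0 then 0 else deriv (deriv φ) (S x) * ŵ μ * ŵ μ := by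
    intro μ
    rw [(hinner μ).fderiv_eq]
    by_cases hμ : μ = 0
    · simp [hμ]
    · simp only [hμ, if_false]
      have h1 : HasFDerivAt (fun y : E4 ↦ deriv φ (S y))
          (deriv (deriv φ) (S x) • (ŵ 1 • E4.dx 1 + ŵ 2 • E4.dx 2 + ŵ 3 • E4.dx 3)) x :=
        hφ2.hasDerivAt.comp_hasFDerivAt x (hSd x)
      have h2 := h1.mul_const (ŵ μ)
      have h2' : HasFDerivAt (fun y : E4 ↦ deriv φ (S y) * ŵ μ) _ x := h2
      rw [h2'.fderiv]
      simp only [FunLike.coe_add, Pi.add_apply, FunLike.coe_smul, Pi.smul_apply, smul_eq_mul,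
        Kerr.dx_basisVector]
      fin_cases μ
      · exact absurd rfl hμ
      all_goals simp; ring
  show ∑ μ, fderiv ℝ (fun y : E4 ↦ ∑ ν, Kerr.etaComp μ ν *
      fderiv ℝ (fun z ↦ φ (ŵ 1 * z 1 + ŵ 2 * z 2 + ŵ 3 * z 3)) y (E4.basisVector ν)) x
        (E4.basisVector μ) = _
  rw [Fin.sum_univ_four, hderiv 0, hderiv 1, hderiv 2, hderiv 3]
  simp only [Fin.isValue, if_true, show (1 : Fin 4) ≠ 0 from by decide,
    show (2 : Fin 4) ≠ 0 from by decide, show (3 : Fin 4) ≠ 0 from by decide, if_false]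
  rw [hS]
  ring

/-- **The corrected mid-frame wall bulk.** For the blended multiplier `X = u + ζ W` across a planar
wall at rest in the pair's mid-frame (`W = κ ŵ`, `ŵ⁰ = 0`, `|ŵ| = 1`, `ζ = Z(ŵ·y⃗)`) and the
Lagrangian corrector `ϖ = 2κ Z'(ŵ·y⃗)`, the bulk of DRSR's modified current
`K^X + ¼ ϖ Q − ⅛ (□_η ϖ) w²` is
`κ [ Z'(σ) (∂_ŵ w)² − ¼ Z'''(σ) w² ]`, `σ = ŵ·x⃗`:
the first-order term is a signed square, the `Q`-term is gone, and the whole unsigned content is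
the zeroth-order term `−¼ κ Z''' w²`. [folklore] -/
theorem modifiedBulk_eta_wall_planar (u W ŵ : Fin 4 → ℝ) {κ : ℝ} {Z : ℝ → ℝ} (hŵ0 : ŵ 0 = 0)
    (hŵ1 : ŵ 1 ^ 2 + ŵ 2 ^ 2 + ŵ 3 ^ 2 = 1) (hW : ∀ μ, W μ = κ * ŵ μ) (w : E4 → ℝ) {x : E4}
    (hZ1 : DifferentiableAt ℝ Z (ŵ 1 * x 1 + ŵ 2 * x 2 + ŵ 3 * x 3))
    (hZ3 : ContDiffAt ℝ 2 (deriv Z) (ŵ 1 * x 1 + ŵ 2 * x 2 + ŵ 3 * x 3)) :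
    KerrSchild.multiplierBulk (fun _ ↦ Kerr.etaComp)
          (fun y α ↦ u α + Z (ŵ 1 * y 1 + ŵ 2 * y 2 + ŵ 3 * y 3) * W α) w x +
        4⁻¹ * ((2 * κ * deriv Z (ŵ 1 * x 1 + ŵ 2 * x 2 + ŵ 3 * x 3)) *
          ∑ α, ∑ β, Kerr.etaComp α β * fderiv ℝ w x (E4.basisVector α) *
            fderiv ℝ w x (E4.basisVector β)) -
        8⁻¹ * KerrSchild.waveOperator (fun _ ↦ Kerr.etaComp)
          (fun y ↦ 2 * κ * deriv Z (ŵ 1 * y 1 + ŵ 2 * y 2 + ŵ 3 * y 3)) x * w x ^ 2 =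
      κ * (deriv Z (ŵ 1 * x 1 + ŵ 2 * x 2 + ŵ 3 * x 3) *
          (∑ μ, ŵ μ * fderiv ℝ w x (E4.basisVector μ)) ^ 2 -
        4⁻¹ * deriv (deriv (deriv Z)) (ŵ 1 * x 1 + ŵ 2 * x 2 + ŵ 3 * x 3) * w x ^ 2) := by
  set σ : ℝ := ŵ 1 * x 1 + ŵ 2 * x 2 + ŵ 3 * x 3 with hσ
  -- the transition `ζ = Z ∘ S` and its differential at `x`
  have hζd : HasFDerivAt (fun y : E4 ↦ Z (ŵ 1 * y 1 + ŵ 2 * y 2 + ŵ 3 * y 3))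
      (deriv Z σ • (ŵ 1 • E4.dx 1 + ŵ 2 • E4.dx 2 + ŵ 3 • E4.dx 3)) x :=
    hZ1.hasDerivAt.comp_hasFDerivAt x (hasFDerivAt_planarCoord ŵ x)
  have hζ : DifferentiableAt ℝ (fun y : E4 ↦ Z (ŵ 1 * y 1 + ŵ 2 * y 2 + ŵ 3 * y 3)) x :=
    hζd.differentiableAt
  have hdζ : ∀ μ, fderiv ℝ (fun y : E4 ↦ Z (ŵ 1 * y 1 + ŵ 2 * y 2 + ŵ 3 * y 3)) x
      (E4.basisVector μ) = deriv Z σ * ŵ μ := by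
    intro μ
    rw [hζd.fderiv]
    simp only [FunLike.coe_add, Pi.add_apply, FunLike.coe_smul, Pi.smul_apply, smul_eq_mul,
      Kerr.dx_basisVector]
    fin_cases μ <;> simp [hŵ0]
  -- the wall identity and the planar wave operator of the corrector
  rw [multiplierBulk_eta_wall u W ŵ hŵ0 hŵ1 hW w hζ hdζ]
  have hϖ : ContDiffAt ℝ 2 (fun t ↦ 2 * κ * deriv Z t) σ := contDiffAt_const.mul hZ3
  rw [waveOperator_eta_planar (φ := fun t ↦ 2 * κ * deriv Z t) ŵ hϖ, hŵ1]
  have hd2 : deriv (deriv fun t ↦ 2 * κ * deriv Z t) σ = 2 * κ * deriv (deriv (deriv Z)) σ := by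
    have h1 : deriv (fun t ↦ 2 * κ * deriv Z t) = fun t ↦ 2 * κ * deriv (deriv Z) t := by
      funext t; exact deriv_const_mul_field _
    rw [h1, deriv_const_mul_field]
  rw [hd2]
  ring

end Summit.FinalStateConjecture.FinalStateConjecture.Cruxes.AdiabaticMultiKerrILED.Sketch

end
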